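import Summits.BirchSwinnertonDyer.BirchSwinnertonDyer.Theses.UniversalToricDescent
import Summits.BirchSwinnertonDyer.BirchSwinnertonDyer.Theorems.UniversalToricDescentToricTransportModThreeStubRatSqueeze
import Summits.BirchSwinnertonDyer.BirchSwinnertonDyer.Theorems.UniversalToricDescentAcDualMuZeroCriterion
import Literature.Barriers.BirchSwinnertonDyer.TraceZeroHeegnerTowerAtAdditiveSplitP
import Mathlib.RingTheory.Polynomial.Cyclotomic.Basic
import HarnessLib

/-!
# NODE `supersingular_toric_test` — crux `AdditiveSplitIMCInclusionAtThree` (stmt-BirchSwinnertonDyer-20395, THE WALL, UTD)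
# crux-ideate round 13 (unit cruxidea-stmt-BirchSwinnertonDyer-20395-1-g13), 2026-08-31

NODE for the crux idea `supersingular-toric-test` (card `Ideas/supersingular-toric-test.md`, line card
`Lines/supersingular_toric_test.md`).  KERNEL ROAD = the toothwise road of node `toothwise_kolyvagin_mu` (g3) BY NAME
(same `Prop`s, restated verbatim in this namespace so the file is self-contained):

  WALL ⟸ RATWALL (24207, WEAKER) + `SelfAlgMuZeroAtThree` ⟸ `IsTorsionOfFiniteToothQuot` (c1, ATTACKABLE algebra)
       + `ToothReadsMu` (c2, ATTACKABLE algebra) + `ToothCardSmallAtThree` (c3, UNDECIDED — the arithmetic leaf).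

WHAT IS NEW HERE is the SOURCE proposed for the leaf c3 and its kernel-checked algebra (§1, all PROVED, no `sorry`):
the `O_k`-INDEX bound `ind_{O_k}(y_k) < e_k/2 − 3^{k−c}` of the trace-zero CM point that c3's Kolyvagin-system step
consumes is certified by a TORIC TEST — the `3`-indivisibility in `E(L_k)` of the bounded VERTICAL PATTERN
`θ_c·y_k = (g−1)(h−1)·y_k` (`g` a generator of `Gal(L_k/L_{k−c})`, `h = g^{3^{c−1}}`) — and the toric test is read
GEOMETRICALLY: reduction at ONE inert Kolyvagin prime `ℓ₀`, Cornut–Vatsal surjectivity for ONE CM point at the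
`3`-deepened level `H_c` (the vertical Galois group acts on the level-`H_c` lift of the conductor-`3^k` CM point by the
FIXED horocyclic translations `R(n(i·3^{−c}))`, independent of `k`), and a FINITE statement (LOC*) in the mod-`3`
representation `π̄(ρ̄_E|G_{ℚ₃})` reached through mod-`3` local–global compatibility on the definite quaternion algebra
`B_{ℓ₀∞}` — no `L`-function, no `p`-adic Waldspurger formula, no admissible prime, no `Λ`-adic class, no patching.
§1 proves the module algebra behind the thresholds over the tree's `TraceZeroTower` API (`(h−1)² = −3h` on trace-zero
vectors, so the one-point and edge statistics are too weak by exactly the Kolyvagin-system constant and a second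
difference with `c ≥ 2` is forced; the edge/toric tests forbid the index decompositions; the `ℕ`-arithmetic of
«test + Kolyvagin bound ⇒ μ = 0»).  The arithmetic inputs (CV surjectivity at level `H_c`, mod-`3` local–global
compatibility at `p = 3`, the finite local statement (LOC*), the DVR Kolyvagin bound with `k`-uniform error) are the
informal leaves of `stub_toothCardSmall` and are spelled out in the line card; nothing about elliptic curves is proved
here beyond the compositions.  BSD is not advanced by this file.

References: [CornutVatsal2007] §4.6 Prop. 4.17, Cor. 4.18, Lemma 4.9 (iii), §6 Def. 6.13 / Lemma 6.14
(= [corpus:book:burns2007-l-functions-galois-representations p.197–200, 158–166]); Cornut–Vatsal, Doc. Math. 10 (2005)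
Thm. 3.5; [Cornut2002]; Vatsal, Invent. Math. 148 (2002), Duke Math. J. 116 (2003); [BertoliniDarmon1996] §2.4–2.5;
Ribet, Invent. Math. 100 (1990) (Ihara / Shimura subgroup); Emerton (2011), Breuil–Diamond (2014), Emerton–Gee–Savitt
(2015), Colmez–Dospinescu–Paškūnas (2014), Paškūnas (2016) (local–global compatibility, p-adic/mod-p Langlands for
GL₂(ℚ_p), p = 3); Morra, «Multiplicity theorems modulo p for GL₂(ℚ_p)» [galaxy:pdf:-5593619698340710920];
[Howard2004HeegnerKolyvagin] §1.6; [MazurRubin2004]; [Washington1997] §7.1, §13.2.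
-/

set_option linter.dupNamespace false
set_option autoImplicit false

noncomputable section

open Literature.NumberTheory.EllipticCurves
open Summit.BirchSwinnertonDyer.BirchSwinnertonDyer.Theses.UniversalToricDescent
  (RationalSplitIMCInclusionAtThree AdditiveSplitIMCInclusionAtThree)
open Summit.BirchSwinnertonDyer.BirchSwinnertonDyer.Cruxes.ToricTransportModThree.RatwallThinComb
  (dvd_of_dvd_prime_pow_mul prime_C_three not_C_three_dvd_of_norm_coeff_eq_one)
open Summit.BirchSwinnertonDyer.Rank1Residual.X11b
open Literature.Barriers.BirchSwinnertonDyer.TraceZeroTower (towerLayer towerNorm IsTraceZeroFamily)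

namespace Summit.BirchSwinnertonDyer.BirchSwinnertonDyer.Cruxes.AdditiveSplitIMCInclusionAtThree.SupersingularToricTest

universe u v

/-! ## §1  The toric test — module algebra over the trace-zero tower (PROVED)

Setting of `Literature.Barriers.BirchSwinnertonDyer.TraceZeroTower`: `R` a commutative ring, `H` an `R`-module
(intended `E(L_∞) ⊗ ℤ₃`), `γ : Module.End R H` (a topological generator), layer `m` = `ker (γ^{3^m} − 1)`, relative
norm `N_{m+1,m} = 1 + h + h²` with `h = γ^{3^m}`.  «Divisible by 3» is `∃ z, v = 3 • z` in `H`. -/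

section Algebra

variable {R : Type u} [CommRing R] {H : Type v} [AddCommGroup H] [Module R H]

/-- The EDGE operator `γ^{3^n} − 1` (= `g − 1` for the Galois element `g = γ^{3^n}`). [BertoliniDarmon1996 §2.4] -/
def edge (γ : Module.End R H) (n : ℕ) : Module.End R H :=
  γ ^ (3 ^ n) - 1

/-- `edge γ n x = γ^{3^n} x − x`. [BertoliniDarmon1996 §2.4] -/
theorem edge_apply (γ : Module.End R H) (n : ℕ) (x : H) : edge γ n x = (γ ^ (3 ^ n)) x - x := by
  simp only [edge, LinearMap.sub_apply, Module.End.one_apply]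

/-- The barrier's layer `n` is the kernel of the edge operator. [BertoliniDarmon1996 §2.4] -/
theorem towerLayer_eq_ker_edge (γ : Module.End R H) (n : ℕ) : towerLayer γ 3 n = LinearMap.ker (edge γ n) :=
  rfl

/-- EDGE TEST at layer `m+1`: `(h − 1)·y ∉ 3H`, `h = γ^{3^m}` (the generator of `Gal(L_{m+1}/L_m)`). [folklore] -/
def EdgeTestAt (γ : Module.End R H) (m : ℕ) (y : H) : Prop :=
  ¬ ∃ z : H, edge γ m y = 3 • z

/-- TORIC TEST with parameters `(c, j)` at layer `j+c+1`: `(h − 1)(g − 1)·y ∉ 3H` with `g = γ^{3^j}` (a generator of the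
vertical group `Gal(L_{j+c+1}/L_j)`, cyclic of order `3^{c+1}` on that layer) and `h = g^{3^c} = γ^{3^{j+c}}`.  Informal
`θ_{c+1} = (g−1)(h−1)`; `c = 0` is the vacuous square `(h−1)²` (`not_toricTestAt_zero`). [this node] -/
def ToricTestAt (γ : Module.End R H) (c j : ℕ) (y : H) : Prop :=
  ¬ ∃ z : H, edge γ (j + c) (edge γ j y) = 3 • z

/-- `N_{m+1,m} x = x + h x + h(h x)`. [BertoliniDarmon1996 §2.4] -/
theorem towerNorm_three_apply (γ : Module.End R H) (m : ℕ) (x : H) :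
    towerNorm γ 3 m x = x + (γ ^ (3 ^ m)) x + (γ ^ (3 ^ m)) ((γ ^ (3 ^ m)) x) := by
  have hsum : towerNorm γ 3 m = 1 + γ ^ (3 ^ m) + γ ^ (3 ^ m) * γ ^ (3 ^ m) := by
    simp [Literature.Barriers.BirchSwinnertonDyer.TraceZeroTower.towerNorm, Finset.sum_range_succ, pow_succ]
  rw [hsum]
  simp only [LinearMap.add_apply, Module.End.one_apply, Module.End.mul_apply]

/-- **`(h − 1)² = −3h` on trace-zero vectors**: if `N_{m+1,m} x = 0` then `(h−1)((h−1)x) = −3·h x`.  This is why the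
one-point statistic `y ∉ 3H` and the edge statistic `(h−1)y ∉ 3H` certify only `ind < e` resp. `ind < e/2`, and why the
square `(h−1)²y` is ALWAYS divisible by `3`: a second difference `(g−1)(h−1)` with `g` of order `≥ 9` is forced.
[folklore: `(ζ₃ − 1)² = −3ζ₃`] -/
theorem edge_edge_apply_of_towerNorm_eq_zero (γ : Module.End R H) (m : ℕ) {x : H}
    (hN : towerNorm γ 3 m x = 0) :
    edge γ m (edge γ m x) = -(3 • (γ ^ (3 ^ m)) x) := by
  rw [towerNorm_three_apply] at hN
  have h2 : (γ ^ (3 ^ m)) ((γ ^ (3 ^ m)) x) = -(x + (γ ^ (3 ^ m)) x) := eq_neg_of_add_eq_zero_right hN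
  simp only [edge_apply, map_sub, h2]
  abel

/-- The edge applied to an «index decomposition» `(h−1)w + 3u` with `w` trace-zero is divisible by `3`.
[this node] -/
theorem edge_apply_edge_decomp (γ : Module.End R H) (m : ℕ) {w : H} (hw : towerNorm γ 3 m w = 0) (u : H) :
    edge γ m (edge γ m w + 3 • u) = 3 • (edge γ m u - (γ ^ (3 ^ m)) w) := by
  rw [map_add, map_nsmul, edge_edge_apply_of_towerNorm_eq_zero γ m hw, smul_sub]
  abel

/-- **Edge door** (shadow of `ind < e/2`): if the edge test holds for `y` then `y ∉ (h−1)·H^{N=0} + 3H`.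
[this node] -/
theorem edgeTest_index_door (γ : Module.End R H) (m : ℕ) {y : H} (hy : EdgeTestAt γ m y) :
    ¬ ∃ w u : H, towerNorm γ 3 m w = 0 ∧ y = edge γ m w + 3 • u := by
  rintro ⟨w, u, hw, rfl⟩
  exact hy ⟨_, edge_apply_edge_decomp γ m hw u⟩

/-- **Toric door** (shadow of `ind < e/2 − 3^{m−c}`): if the toric test with parameters `(c, j)` holds for `y` then
`(g−1)·y ∉ (h−1)·H^{N=0} + 3H` (`g = γ^{3^j}`, `h = γ^{3^{j+c}}`); in the DVR `O = ℤ₃[ζ_{3^{j+c+1}}]` this reads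
`v_π((g−1)y) < e/2`, i.e. `ind(y) < e/2 − v_π(ζ_{3^{c+1}} − 1) = e/2 − 3^{j}`. [this node] -/
theorem toricTest_index_door (γ : Module.End R H) (c j : ℕ) {y : H} (hy : ToricTestAt γ c j y) :
    ¬ ∃ w u : H, towerNorm γ 3 (j + c) w = 0 ∧ edge γ j y = edge γ (j + c) w + 3 • u := by
  rintro ⟨w, u, hw, hyw⟩
  exact hy ⟨_, by rw [hyw]; exact edge_apply_edge_decomp γ (j + c) hw u⟩

/-- The parameter `c = 0` (informal `θ₁ = (h−1)²`) is VACUOUS on trace-zero vectors: the test always fails.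
[this node] -/
theorem not_toricTestAt_zero (γ : Module.End R H) (j : ℕ) {y : H} (hy : towerNorm γ 3 j y = 0) :
    ¬ ToricTestAt γ 0 j y := by
  intro h
  apply h
  refine ⟨-((γ ^ (3 ^ j)) y), ?_⟩
  rw [Nat.add_zero, edge_edge_apply_of_towerNorm_eq_zero γ j hy, smul_neg]

/-- Conversely the toric test at `(c, j)` implies the edge test for `g = γ^{3^j}` up to the factor `h − 1`: if
`(g−1)y ∈ 3H` then `(h−1)(g−1)y ∈ 3H`. [this node] -/
theorem edgeTestAt_of_toricTestAt (γ : Module.End R H) (c j : ℕ) {y : H} (hy : ToricTestAt γ c j y) :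
    EdgeTestAt γ j y := by
  rintro ⟨z, hz⟩
  exact hy ⟨edge γ (j + c) z, by rw [hz, map_nsmul]⟩

/-- A trace-zero family is trace-zero at every layer in the sense used above (bookkeeping against the barrier's
`IsTraceZeroFamily`). [BertoliniDarmon1996 §2.5 Case 2] -/
theorem towerNorm_eq_zero_of_isTraceZeroFamily {γ : Module.End R H} {y : ℕ → H}
    (hy : IsTraceZeroFamily γ 3 y) (k : ℕ) : towerNorm γ 3 k (y (k + 1)) = 0 :=
  hy.2 k

end Algebra

/-! ### The `ℕ`-arithmetic of «toric test + Kolyvagin bound ⇒ μ = 0» -/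

/-- `φ(3^{k+1}) = 2·3^k` (= `e_{k+1}`, the ramification index of `ℤ₃[ζ_{3^{k+1}}]`; `v_π(ζ₃ − 1) = e/2`).
[Washington1997 §7.1] -/
theorem totient_three_pow_succ (k : ℕ) : Nat.totient (3 ^ (k + 1)) = 2 * 3 ^ k := by
  rw [Nat.totient_prime_pow_succ Nat.prime_three]
  omega

/-- **Threshold arithmetic.**  With `e = e_k`, `ind = ind_{O_k}(y_k)`, `t = 3^{k−c}`: the DVR Kolyvagin-system bound
`e·μ + λ ≤ 2·ind + C` (c3's step T1, error `C` uniform in `k`), the toric test output `2·ind + 2t ≤ e`, and `k` large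
enough that `C < 2t + λ`, force `μ = 0`.  (With the edge test alone, `t = 0`, the hypothesis `C < λ` is not available:
the margin is eaten by the constant.) [this node; Howard2004HeegnerKolyvagin §1.6 for the shape of the bound] -/
theorem mu_eq_zero_of_toric_threshold {e ind C lam mu t : ℕ}
    (hKS : e * mu + lam ≤ 2 * ind + C) (htest : 2 * ind + 2 * t ≤ e) (hlarge : C < 2 * t + lam) : mu = 0 := by
  have h1 : e * mu < e * 1 := by rw [mul_one]; omega
  have h2 : mu < 1 := Nat.lt_of_mul_lt_mul_left h1
  omega

/-! ## §2  The cyclotomic teeth of `Λ = ℤ₃⟦T⟧` and the pieces (verbatim from node `toothwise_kolyvagin_mu`, g3) -/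

/-- The `k`-th CYCLOTOMIC TOOTH `𝔮_k = Φ_{3^k}(1+T) ∈ Λ = ℤ₃⟦T⟧` (`Λ/𝔮_k ≅ ℤ₃[ζ_{3^k}] = O_k`, the ring where a
TRACE-ZERO layer-`k` class lives). [folklore; Washington1997 §7.1] -/
def tooth (k : ℕ) : IwasawaAlgebra 3 :=
  (((Polynomial.cyclotomic (3 ^ k) ℤ_[3]).comp (Polynomial.X + 1) : Polynomial ℤ_[3]) : PowerSeries ℤ_[3])

/-- The specialisation `M ⧸ 𝔮_k M` of a `Λ`-module at the `k`-th tooth. [folklore] -/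
abbrev ToothQuot (M : Type) [AddCommGroup M] [Module (IwasawaAlgebra 3) M] (k : ℕ) : Type :=
  M ⧸ (Ideal.span {tooth k} • (⊤ : Submodule (IwasawaAlgebra 3) M))

/-- PIECE B (UNDECIDED; EQUIV-type w.r.t. the kernel road): the curve's own algebraic `μ = 0` at additive split 3 in
the route's `R₀⟦T⟧` currency — `X_(∅,0)(E/K_∞)` strict at `𝔭′` is `Λ`-torsion and `Ch_Λ(X)·R₀⟦T⟧ = (g′)` with a
coefficient of `3`-adic norm `1`.  Verbatim the g3 statement. -/
def SelfAlgMuZeroAtThree : Prop :=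
  ∀ (W : WeierstrassCurve ℚ) [W.IsElliptic] [W.IsGloballyMinimal] (N : ℕ) [NeZero N] (K : Type) [Field K]
    [NumberField K] (Dt : Literature.NumberTheory.EllipticCurves.ModularForms.ModularParametrizationData W N),
    Summit.BirchSwinnertonDyer.Rank1Residual.Additive.ClassO6 W 3 → W.HasSurjectiveModNGaloisRep 3 →
    W.analyticRank = 1 → W.conductorNorm ℤ = N → Literature.NumberTheory.EllipticCurves.IsImaginaryQuadratic K →
    Literature.NumberTheory.EllipticCurves.SatisfiesHeegnerHypothesis N K →
    ∀ (κ : Literature.NumberTheory.EllipticCurves.ZpExtension K 3), κ.IsAnticyclotomic →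
    ∀ (γ : Field.absoluteGaloisGroup K) [Fact (κ.IsTopGenerator γ)]
      (𝔭 : IsDedekindDomain.HeightOneSpectrum (NumberField.RingOfIntegers K)),
      ((3 : ℕ) : NumberField.RingOfIntegers K) ∈ 𝔭.asIdeal →
      𝔭.asIdeal.ramificationIdx (NumberField.RingOfIntegers ℚ) = 1 →
      𝔭.asIdeal.inertiaDeg (NumberField.RingOfIntegers ℚ) = 1 →
    ∀ (𝔭' : IsDedekindDomain.HeightOneSpectrum (NumberField.RingOfIntegers K)),
      ((3 : ℕ) : NumberField.RingOfIntegers K) ∈ 𝔭'.asIdeal → 𝔭' ≠ 𝔭 →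
    Module.IsTorsion (IwasawaAlgebra 3) (AcSelmer.XAc (W.baseChange K) 3 κ 𝔭' ∅ γ) ∧
      ∃ g' : UnrSeries 3,
        (AcSelmer.XAc.charIdeal (W.baseChange K) 3 κ 𝔭' ∅ γ).map (PowerSeries.map (Halves.toUnr 3)) =
            Ideal.span {g'} ∧
          ∃ i : ℕ, ‖((PowerSeries.coeff i g' : unrIntegers 3) : ℂ_[3])‖ = 1

/-- PIECE c1 (ATTACKABLE, pure `Λ`-algebra): a finitely generated `Λ`-module with ONE finite tooth specialisation is
`Λ`-torsion.  Verbatim the g3 statement. [folklore; Washington1997 §13.2] -/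
def IsTorsionOfFiniteToothQuot : Prop :=
  ∀ (M : Type) [AddCommGroup M] [Module (IwasawaAlgebra 3) M] [Module.Finite (IwasawaAlgebra 3) M],
    (∃ k : ℕ, Finite (ToothQuot M k)) → Module.IsTorsion (IwasawaAlgebra 3) M

/-- PIECE c2 (ATTACKABLE, pure `Λ`-algebra): THE TEETH READ `μ` — if `#(M ⧸ 𝔮_k M)² ≤ 3^{φ(3^k)}` for infinitely
many `k` then `μ(M) = 0`.  Verbatim the g3 statement. [Washington1997 §7.1 Prop. 7.2, §13.2 Thm. 13.12] -/
def ToothReadsMu : Prop :=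
  ∀ (M : Type) [AddCommGroup M] [Module (IwasawaAlgebra 3) M] [Module.Finite (IwasawaAlgebra 3) M],
    Module.IsTorsion (IwasawaAlgebra 3) M →
    (∀ k₀ : ℕ, ∃ k : ℕ, k₀ ≤ k ∧ Finite (ToothQuot M k) ∧
        Nat.card (ToothQuot M k) ^ 2 ≤ 3 ^ Nat.totient (3 ^ k)) →
    muInvariant 3 M = 0

/-- PIECE c3 — THE ARITHMETIC LEAF (UNDECIDED; RE-SOURCED by this node): at infinitely many cyclotomic teeth the
`(∅,0)` anticyclotomic Selmer dual of the wild curve has a finite specialisation of order `< 3^{φ(3^k)/2}`.  Verbatim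
the g3 statement; the NEW informal engine (line card §Stubs) is TT1 + T1:
TT1 (TORIC-TEST SUPPLY): for `c = 2` and all `k ≫ 0`, `θ_c·y_k ∉ 3E(L_k)` — by the contrapositive chain
[CV surjectivity for the level-`H_c` lift of the conductor-`3^k` CM point at one inert Kolyvagin prime `ℓ₀`]
+ [Ihara: the mod-3 supersingular avatar `ψ̄` of `f` on `B_{ℓ₀∞}` is nonzero] + [mod-3 local–global compatibility on
`B_{ℓ₀∞}` at `p = 3`] + [(LOC*_c): the horocyclic second difference `([n(3^{−c})]−1)([n(3^{−1})]−1)` kills no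
nonzero mod-3 shadow newvector of `π̄(ρ̄_E|G_{ℚ₃})` at level `U₀(3^δ)`]; then `toricTest_index_door` gives
`ind_{O_k}(y_k) < e_k/2 − 3^{k−c}`;
T1 (DVR KOLYVAGIN BOUND, shared with g3): `e_k·μ + λ ≤ 2·ind + C` with `C` uniform in `k`, and PT/control for
`(∅,0)`; `mu_eq_zero_of_toric_threshold` is the arithmetic of the conclusion.
Why it might fail: (LOC*_2) may fail for a Kraus cell (escalate `c`), mod-3 local–global compatibility at `p = 3` is a
port with genericity conditions on `ρ̄|G_{ℚ₃}`, CV surjectivity at the non-Eichler `3`-level `H_c` with `27 ∣ N` is a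
port of CV05 Thm. 3.5, and the test certifies `ind < e/3`, more than `μ = 0` needs. -/
def ToothCardSmallAtThree : Prop :=
  ∀ (W : WeierstrassCurve ℚ) [W.IsElliptic] [W.IsGloballyMinimal] (N : ℕ) [NeZero N] (K : Type) [Field K]
    [NumberField K] (Dt : Literature.NumberTheory.EllipticCurves.ModularForms.ModularParametrizationData W N),
    Summit.BirchSwinnertonDyer.Rank1Residual.Additive.ClassO6 W 3 → W.HasSurjectiveModNGaloisRep 3 →
    W.analyticRank = 1 → W.conductorNorm ℤ = N → Literature.NumberTheory.EllipticCurves.IsImaginaryQuadratic K →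
    Literature.NumberTheory.EllipticCurves.SatisfiesHeegnerHypothesis N K →
    ∀ (κ : Literature.NumberTheory.EllipticCurves.ZpExtension K 3), κ.IsAnticyclotomic →
    ∀ (γ : Field.absoluteGaloisGroup K) [Fact (κ.IsTopGenerator γ)]
      (𝔭 : IsDedekindDomain.HeightOneSpectrum (NumberField.RingOfIntegers K)),
      ((3 : ℕ) : NumberField.RingOfIntegers K) ∈ 𝔭.asIdeal →
      𝔭.asIdeal.ramificationIdx (NumberField.RingOfIntegers ℚ) = 1 →
      𝔭.asIdeal.inertiaDeg (NumberField.RingOfIntegers ℚ) = 1 →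
    ∀ (𝔭' : IsDedekindDomain.HeightOneSpectrum (NumberField.RingOfIntegers K)),
      ((3 : ℕ) : NumberField.RingOfIntegers K) ∈ 𝔭'.asIdeal → 𝔭' ≠ 𝔭 →
    ∀ k₀ : ℕ, ∃ k : ℕ, k₀ ≤ k ∧ Finite (ToothQuot (AcSelmer.XAc (W.baseChange K) 3 κ 𝔭' ∅ γ) k) ∧
      Nat.card (ToothQuot (AcSelmer.XAc (W.baseChange K) 3 κ 𝔭' ∅ γ) k) ^ 2 ≤ 3 ^ Nat.totient (3 ^ k)

/-! ## §3  Registered stubs (the pieces as `sorry`s; nothing else in this file is sorried) -/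

/-- STUB (WEAKER — route item 24207 `RationalSplitIMCInclusionAtThree` BY NAME; live LEAD cruxlead-24207). -/
theorem stub_ratwall : RationalSplitIMCInclusionAtThree := by
  sorry

/-- STUB (ATTACKABLE — piece c1, pure algebra; identical to g3's `stub_isTorsionOfFiniteToothQuot`). -/
theorem stub_isTorsionOfFiniteToothQuot : IsTorsionOfFiniteToothQuot := by
  sorry

/-- STUB (ATTACKABLE — piece c2, pure algebra; identical to g3's `stub_toothReadsMu`). -/
theorem stub_toothReadsMu : ToothReadsMu := by
  sorry

/-- STUB (UNDECIDED — piece c3, the arithmetic leaf, RE-SOURCED: toric-test supply TT1 (CV at level `H_c` + Ihara +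
mod-3 local–global compatibility + (LOC*_c)) and the DVR Kolyvagin bound T1; see the docstring of
`ToothCardSmallAtThree` and the line card). -/
theorem stub_toothCardSmall : ToothCardSmallAtThree := by
  sorry

/-! ## §4  Compositions (kernel-checked, no `sorry`) -/

/-- **Self-`μ = 0` from the teeth** (verbatim the g3 child composition): `X = X_(∅,0)(E/K_∞)` is finitely generated
over `Λ` (LANDED, `AcSelmer.XAc.module_finite`); one finite tooth specialisation makes it torsion (c1); small tooth
specialisations infinitely often make `μ(X) = 0` (c2 fed by c3); and `μ = 0` for a finitely generated torsion `X` is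
the route's `R₀⟦T⟧` currency (LANDED,
`UniversalToricDescentAcDualMuZero.exists_map_charIdeal_eq_span_of_muInvariant_eq_zero`).
[GreenbergVatsal2000 §2 Prop. 2.8; Washington1997 §13.2] -/
theorem selfAlgMuZeroAtThree_of_teeth :
    IsTorsionOfFiniteToothQuot → ToothReadsMu → ToothCardSmallAtThree → SelfAlgMuZeroAtThree := by
  intro h1 h2 h3 W _ _ N _ K _ _ Dt hO6 hsurj hr1 hN hK hH κ hκ γ _ 𝔭 hp3 he hf 𝔭' h3' hne
  haveI : Module.Finite (IwasawaAlgebra 3) (AcSelmer.XAc (W.baseChange K) 3 κ 𝔭' ∅ γ) :=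
    AcSelmer.XAc.module_finite κ 𝔭' ∅ γ Set.finite_empty (W := W.baseChange K)
  have hsmall := h3 W N K Dt hO6 hsurj hr1 hN hK hH κ hκ γ 𝔭 hp3 he hf 𝔭' h3' hne
  obtain ⟨k, -, hfin, -⟩ := hsmall 0
  have hT : Module.IsTorsion (IwasawaAlgebra 3) (AcSelmer.XAc (W.baseChange K) 3 κ 𝔭' ∅ γ) :=
    h1 (AcSelmer.XAc (W.baseChange K) 3 κ 𝔭' ∅ γ) ⟨k, hfin⟩
  have hμ : muInvariant 3 (AcSelmer.XAc (W.baseChange K) 3 κ 𝔭' ∅ γ) = 0 :=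
    h2 (AcSelmer.XAc (W.baseChange K) 3 κ 𝔭' ∅ γ) hT hsmall
  exact ⟨hT, Summit.BirchSwinnertonDyer.BirchSwinnertonDyer.Theorems.UniversalToricDescentAcDualMuZero.exists_map_charIdeal_eq_span_of_muInvariant_eq_zero
    (AcSelmer.XAc (W.baseChange K) 3 κ 𝔭' ∅ γ) hT hμ⟩

/-- **The wall from the rational wall and the curve's own `μ = 0`** (verbatim the g3 top composition: 3-saturation
in the domain `R₀⟦T⟧`, where `3` is prime and `g′` has a unit coefficient). [folklore; Washington1997 §7.1] -/
theorem additiveSplit_of_ratwall_of_selfAlgMuZero :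
    RationalSplitIMCInclusionAtThree → SelfAlgMuZeroAtThree → AdditiveSplitIMCInclusionAtThree := by
  intro hR hM W _ _ N _ K _ _ Dt hO6 hsurj hr1 hN hK hH κ hκ γ _ 𝔭 h3 he hf 𝔭' h3' hne ι' hι ΩK Ωp L hΩK hΩp hL
  obtain ⟨k, hk⟩ := hR W N K Dt hO6 hsurj hr1 hN hK hH κ hκ γ 𝔭 h3 he hf 𝔭' h3' hne ι' hι ΩK Ωp L hΩK hΩp hL
  obtain ⟨-, g, hg, i, hi⟩ := hM W N K Dt hO6 hsurj hr1 hN hK hH κ hκ γ 𝔭 h3 he hf 𝔭' h3' hne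
  rw [hg] at hk ⊢
  have hdvd : g ∣ ((3 : ℕ) : UnrSeries 3) ^ k * L := Ideal.mem_span_singleton.mp hk
  rw [← map_natCast (PowerSeries.C (R := unrIntegers 3))] at hdvd
  exact Ideal.span_singleton_le_span_singleton.mpr
    (dvd_of_dvd_prime_pow_mul prime_C_three (not_C_three_dvd_of_norm_coeff_eq_one hi) k hdvd)

/-- **TOP COMPOSITION — concludes the crux `AdditiveSplitIMCInclusionAtThree` BY NAME** from the four registered
stub statements: RATWALL, the two tooth-algebra pieces and the (re-sourced) arithmetic leaf. -/
theorem AdditiveSplitIMCInclusionAtThree_of :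
    RationalSplitIMCInclusionAtThree → IsTorsionOfFiniteToothQuot → ToothReadsMu → ToothCardSmallAtThree →
      Summit.BirchSwinnertonDyer.BirchSwinnertonDyer.Theses.UniversalToricDescent.AdditiveSplitIMCInclusionAtThree :=
  fun hR h1 h2 h3 ↦ additiveSplit_of_ratwall_of_selfAlgMuZero hR (selfAlgMuZeroAtThree_of_teeth h1 h2 h3)

end Summit.BirchSwinnertonDyer.BirchSwinnertonDyer.Cruxes.AdditiveSplitIMCInclusionAtThree.SupersingularToricTest

end
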